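import Summits.Ventures.LatticeQCDFlow.Scoring.UNHaarTraceFourthMoment
import Summits.Ventures.LatticeQCDFlow.Scoring.OnePlaquetteHaarMGF
import HarnessLib

/-!
# `∫_{U(N)} (Re tr U)⁴ dU = 3/4` and the fourth Taylor coefficient of `det[I_{|i−j|}(x)]`: the strong-coupling moments of the `U(N)` plaquette to order 4

HONEST FRAMING: exact (Metropolis-corrected) sampling algorithms for lattice gauge theory;
figures of merit are autocorrelation/cost numbers at stated couplings and volumes; no
continuum-physics claim.

Venture `LatticeQCDFlow` (cell pub-lqcd), sub-topic `Scoring`; FANOUT row 5 (`s0-sun-a`), GEN-20.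
NEW WORK of the cell (placement rule).  Sequel of `UNHaarTraceFourthMoment` (`∫ |tr U|⁴ = 2`) and `OnePlaquetteHaarMGF`
(`mgf_{Re tr U}(x) = det[I_{|i−j|}(x)]`):

* §1 the central circles kill the unbalanced trace monomials: `∫ (tr U)⁴ = 0` (centre element `w·1`, `w = e^{iπ/4}`, `w⁴ = −1`)
  and `∫ (tr U)³·conj(tr U) = 0` (centre element `i·1`);
* §2 **`∫_{U(N)} (Re tr U)⁴ dU = 3/4`** for every `N ≥ 2` (`= (6/16)·∫|tr U|⁴`), which is `3·(∫ (Re tr U)²)²`: the FOURTH CUMULANT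
  of `Re tr U_p` at `β = 0` VANISHES for every `N ≥ 2` (for `N = 1` it is `3/8 − 3/4 = −3/8`);
* §3 **`(det[I_{|i−j|}])⁗(0) = 3/4`** (`iteratedDeriv 4` of the Toeplitz–Bessel determinant at `0`, every `N ≥ 2`), i.e. the one-plaquette
  partition function is `Z_N(x) = 1 + x²/4 + x⁴/32 + O(x⁶)` = `e^{x²/4}` through order 4: Gross–Witten's "no corrections before
  order `2N+2`" at its first instance.

No `def`, nothing cited as a fact, 0 sorry.
-/

noncomputable section

open Real MeasureTheory Filter Topology Finset Complex ProbabilityTheory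
open Literature.MathematicalPhysics.QuantumFieldTheory
open Literature.MathematicalPhysics.QuantumLattice
open Literature.Analysis.FunctionSpaces (besselI)
open Summit.Ventures.LatticeQCDFlow.TrivializingMaps

namespace Summit.Ventures.LatticeQCDFlow.Scoring

variable {N : ℕ}

/-! ## §1 Central circles -/

/-- The central element `w·1 ∈ U(N)` for `w ∈ S¹`. -/
theorem circle_smul_one_mem_unitaryGroup (w : Circle) :
    ((w : ℂ) • (1 : Matrix (Fin N) (Fin N) ℂ)) ∈ Matrix.unitaryGroup (Fin N) ℂ := by
  rw [Matrix.mem_unitaryGroup_iff, star_smul, star_one, Matrix.smul_mul, Matrix.mul_smul, one_mul, smul_smul,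
    Complex.star_def, ← Circle.coe_inv_eq_conj, ← Circle.coe_mul, mul_inv_cancel, Circle.coe_one, one_smul]

/-- `tr((w·1)·U) = w · tr U`. -/
theorem trace_circle_smul_one_mul (w : Circle) (U : Matrix (Fin N) (Fin N) ℂ) :
    (((w : ℂ) • (1 : Matrix (Fin N) (Fin N) ℂ)) * U).trace = (w : ℂ) * U.trace := by
  rw [Matrix.smul_mul, one_mul, Matrix.trace_smul, smul_eq_mul]

/-- **`∫_{U(N)} (tr U)⁴ dU = 0`**: under the central `w·1` with `w⁴ = −1` the integrand changes sign. -/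
theorem un_integral_trace_pow_four_eq_zero :
    ∫ U, ((U : Matrix (Fin N) (Fin N) ℂ)).trace ^ 4 ∂(haarProbability (Matrix.unitaryGroup (Fin N) ℂ)) = 0 := by
  obtain ⟨w, hw⟩ := exists_circle_sq_eq_I
  have hw4 : (w : ℂ) ^ 4 = -1 := by rw [show (w : ℂ) ^ 4 = ((w : ℂ) ^ 2) ^ 2 by ring, hw, Complex.I_sq]
  have key := integral_mul_left_eq_self (μ := (haarProbability (Matrix.unitaryGroup (Fin N) ℂ))) (fun U : Matrix.unitaryGroup (Fin N) ℂ => ((U : Matrix (Fin N) (Fin N) ℂ)).trace ^ 4)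
    ⟨(w : ℂ) • 1, circle_smul_one_mem_unitaryGroup w⟩
  have hent : ∀ U : Matrix.unitaryGroup (Fin N) ℂ, (((⟨(w : ℂ) • 1, circle_smul_one_mem_unitaryGroup w⟩ * U :
      Matrix.unitaryGroup (Fin N) ℂ) : Matrix (Fin N) (Fin N) ℂ)).trace = (w : ℂ) * ((U : Matrix (Fin N) (Fin N) ℂ)).trace := fun U =>
    trace_circle_smul_one_mul w _
  simp only [hent, mul_pow, hw4, neg_one_mul, integral_neg] at key
  have h2 : (2 : ℂ) * ∫ U, ((U : Matrix (Fin N) (Fin N) ℂ)).trace ^ 4 ∂(haarProbability (Matrix.unitaryGroup (Fin N) ℂ)) = 0 := by linear_combination -key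
  simpa using h2

/-- **`∫_{U(N)} (tr U)³·conj(tr U) dU = 0`**: under the central `i·1` the integrand changes sign (`i³·(−i) = −1`). -/
theorem un_integral_trace_pow_three_mul_conj_eq_zero :
    ∫ U, ((U : Matrix (Fin N) (Fin N) ℂ)).trace ^ 3 * (starRingEnd ℂ) ((U : Matrix (Fin N) (Fin N) ℂ)).trace ∂(haarProbability (Matrix.unitaryGroup (Fin N) ℂ)) = 0 := by
  have key := integral_mul_left_eq_self (μ := (haarProbability (Matrix.unitaryGroup (Fin N) ℂ)))
    (fun U : Matrix.unitaryGroup (Fin N) ℂ => ((U : Matrix (Fin N) (Fin N) ℂ)).trace ^ 3 * (starRingEnd ℂ) ((U : Matrix (Fin N) (Fin N) ℂ)).trace) ⟨(I : ℂ) • 1, I_smul_one_mem_unitaryGroup⟩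
  simp only [trace_I_smul_one_mul, map_mul, Complex.conj_I, mul_pow] at key
  have hI : ∀ U : Matrix.unitaryGroup (Fin N) ℂ, I ^ 3 * ((U : Matrix (Fin N) (Fin N) ℂ)).trace ^ 3 * (-I * (starRingEnd ℂ) ((U : Matrix (Fin N) (Fin N) ℂ)).trace)
      = -(((U : Matrix (Fin N) (Fin N) ℂ)).trace ^ 3 * (starRingEnd ℂ) ((U : Matrix (Fin N) (Fin N) ℂ)).trace) := fun U => by
    have h4 : I ^ 3 * -I = -1 := by linear_combination (1 - I ^ 2) * Complex.I_sq
    linear_combination (((U : Matrix (Fin N) (Fin N) ℂ)).trace ^ 3 * (starRingEnd ℂ) ((U : Matrix (Fin N) (Fin N) ℂ)).trace) * h4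
  simp only [hI, integral_neg] at key
  have h2 : (2 : ℂ) * ∫ U, ((U : Matrix (Fin N) (Fin N) ℂ)).trace ^ 3 * (starRingEnd ℂ) ((U : Matrix (Fin N) (Fin N) ℂ)).trace ∂(haarProbability (Matrix.unitaryGroup (Fin N) ℂ)) = 0 := by linear_combination -key
  simpa using h2

/-- … and its conjugate `∫ tr U · conj(tr U)³ dU = 0`. -/
theorem un_integral_trace_mul_conj_pow_three_eq_zero :
    ∫ U, ((U : Matrix (Fin N) (Fin N) ℂ)).trace * (starRingEnd ℂ) ((U : Matrix (Fin N) (Fin N) ℂ)).trace ^ 3 ∂(haarProbability (Matrix.unitaryGroup (Fin N) ℂ)) = 0 := by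
  have h := congrArg (starRingEnd ℂ) (un_integral_trace_pow_three_mul_conj_eq_zero (N := N))
  rw [map_zero, ← integral_conj] at h
  simpa [map_mul, map_pow, Complex.conj_conj, mul_comm] using h

/-- … and `∫ conj(tr U)⁴ dU = 0`. -/
theorem un_integral_conj_trace_pow_four_eq_zero :
    ∫ U, (starRingEnd ℂ) ((U : Matrix (Fin N) (Fin N) ℂ)).trace ^ 4 ∂(haarProbability (Matrix.unitaryGroup (Fin N) ℂ)) = 0 := by
  have h := congrArg (starRingEnd ℂ) (un_integral_trace_pow_four_eq_zero (N := N))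
  rw [map_zero, ← integral_conj] at h
  simpa [map_pow] using h

/-! ## §2 `∫_{U(N)} (Re tr U)⁴ dU = 3/4` -/

/-- Binomial expansion of `(Re z)⁴` in `z` and `z̄` (as complex numbers). -/
theorem ofReal_re_pow_four (z : ℂ) :
    (((z.re ^ 4 : ℝ)) : ℂ) = 1 / 16 * (z ^ 4 + 4 * (z ^ 3 * (starRingEnd ℂ) z) + 6 * ((Complex.normSq z ^ 2 : ℝ) : ℂ)
      + 4 * (z * (starRingEnd ℂ) z ^ 3) + (starRingEnd ℂ) z ^ 4) := by
  rw [Complex.ofReal_pow, Complex.re_eq_add_conj, Complex.ofReal_pow, ← Complex.mul_conj]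
  ring

/-- **`∫_{U(N)} (Re tr U)⁴ dU = 3/4`** for every `N ≥ 2` — three times the square of `∫ (Re tr U)² = 1/2`: the fourth cumulant of
`Re tr U_p` under the Haar measure vanishes. -/
theorem un_integral_re_trace_pow_four (hN : 2 ≤ N) :
    ∫ U, ((U : Matrix (Fin N) (Fin N) ℂ)).trace.re ^ 4 ∂(haarProbability (Matrix.unitaryGroup (Fin N) ℂ)) = 3 / 4 := by
  have c_tr : Continuous fun U : Matrix.unitaryGroup (Fin N) ℂ => ((U : Matrix (Fin N) (Fin N) ℂ)).trace := continuous_subtype_val.matrix_trace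
  have c_cj : Continuous fun U : Matrix.unitaryGroup (Fin N) ℂ => (starRingEnd ℂ) ((U : Matrix (Fin N) (Fin N) ℂ)).trace := Complex.continuous_conj.comp c_tr
  have ia : Integrable (fun U : Matrix.unitaryGroup (Fin N) ℂ => ((U : Matrix (Fin N) (Fin N) ℂ)).trace ^ 4) (haarProbability (Matrix.unitaryGroup (Fin N) ℂ)) :=
    integrable_haarUN_of_continuous (c_tr.pow 4)
  have ib : Integrable (fun U : Matrix.unitaryGroup (Fin N) ℂ => 4 * (((U : Matrix (Fin N) (Fin N) ℂ)).trace ^ 3 * (starRingEnd ℂ) ((U : Matrix (Fin N) (Fin N) ℂ)).trace)) (haarProbability (Matrix.unitaryGroup (Fin N) ℂ)) :=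
    integrable_haarUN_of_continuous (continuous_const.mul ((c_tr.pow 3).mul c_cj))
  have ic : Integrable (fun U : Matrix.unitaryGroup (Fin N) ℂ => 6 * ((Complex.normSq ((U : Matrix (Fin N) (Fin N) ℂ)).trace ^ 2 : ℝ) : ℂ)) (haarProbability (Matrix.unitaryGroup (Fin N) ℂ)) :=
    integrable_haarUN_of_continuous (continuous_const.mul (Complex.continuous_ofReal.comp
      ((Complex.continuous_normSq.comp c_tr).pow 2)))
  have id' : Integrable (fun U : Matrix.unitaryGroup (Fin N) ℂ => 4 * (((U : Matrix (Fin N) (Fin N) ℂ)).trace * (starRingEnd ℂ) ((U : Matrix (Fin N) (Fin N) ℂ)).trace ^ 3)) (haarProbability (Matrix.unitaryGroup (Fin N) ℂ)) :=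
    integrable_haarUN_of_continuous (continuous_const.mul (c_tr.mul (c_cj.pow 3)))
  have ie : Integrable (fun U : Matrix.unitaryGroup (Fin N) ℂ => (starRingEnd ℂ) ((U : Matrix (Fin N) (Fin N) ℂ)).trace ^ 4) (haarProbability (Matrix.unitaryGroup (Fin N) ℂ)) :=
    integrable_haarUN_of_continuous (c_cj.pow 4)
  have hfun : (fun U : Matrix.unitaryGroup (Fin N) ℂ => (((((U : Matrix (Fin N) (Fin N) ℂ)).trace.re ^ 4 : ℝ)) : ℂ)) = fun U : Matrix.unitaryGroup (Fin N) ℂ =>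
      1 / 16 * (((U : Matrix (Fin N) (Fin N) ℂ)).trace ^ 4 + 4 * (((U : Matrix (Fin N) (Fin N) ℂ)).trace ^ 3 * (starRingEnd ℂ) ((U : Matrix (Fin N) (Fin N) ℂ)).trace) + 6 * ((Complex.normSq ((U : Matrix (Fin N) (Fin N) ℂ)).trace ^ 2 : ℝ) : ℂ)
        + 4 * (((U : Matrix (Fin N) (Fin N) ℂ)).trace * (starRingEnd ℂ) ((U : Matrix (Fin N) (Fin N) ℂ)).trace ^ 3) + (starRingEnd ℂ) ((U : Matrix (Fin N) (Fin N) ℂ)).trace ^ 4) := by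
    funext U
    exact ofReal_re_pow_four _
  have h : ∫ U, (((((U : Matrix (Fin N) (Fin N) ℂ)).trace.re ^ 4 : ℝ)) : ℂ) ∂(haarProbability (Matrix.unitaryGroup (Fin N) ℂ)) = ((3 / 4 : ℝ) : ℂ) := by
    rw [hfun, integral_const_mul, integral_add (((ia.fun_add ib).fun_add ic).fun_add id') ie,
      integral_add ((ia.fun_add ib).fun_add ic) id', integral_add (ia.fun_add ib) ic, integral_add ia ib,
      integral_const_mul, integral_const_mul, integral_const_mul, un_integral_trace_pow_four_eq_zero,
      un_integral_trace_pow_three_mul_conj_eq_zero, un_integral_trace_mul_conj_pow_three_eq_zero,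
      un_integral_conj_trace_pow_four_eq_zero, integral_complex_ofReal, un_integral_normSq_trace_sq hN]
    push_cast
    ring
  rw [integral_complex_ofReal] at h
  exact_mod_cast h

/-- The Wick/Gaussian relation at order 4: `∫ (Re tr U)⁴ = 3·(∫ (Re tr U)²)²` (`N ≥ 2`), i.e. zero fourth cumulant. -/
theorem un_integral_re_trace_pow_four_eq_three_mul_sq (hN : 2 ≤ N) :
    ∫ U, ((U : Matrix (Fin N) (Fin N) ℂ)).trace.re ^ 4 ∂(haarProbability (Matrix.unitaryGroup (Fin N) ℂ)) = 3 * (∫ U, ((U : Matrix (Fin N) (Fin N) ℂ)).trace.re ^ 2 ∂(haarProbability (Matrix.unitaryGroup (Fin N) ℂ))) ^ 2 := by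
  rw [un_integral_re_trace_pow_four hN, un_haarSqReTrace_eq_half (N := N) (by omega)]
  norm_num

/-! ## §3 The fourth Taylor coefficient of `det[I_{|i−j|}(x)]` at `x = 0` -/

/-- **`(det[I_{|i−j|}])⁗(0) = 3/4`** for every `N ≥ 2`: with `det[I_{|i−j|}](0) = 1`, `′(0) = 0`, `″(0) = 1/2`, `‴(0) = 0` this says
`det[I_{|i−j|}(x)]_{N×N} = 1 + x²/4 + x⁴/32 + O(x⁶) = e^{x²/4} + O(x⁶)` (no finite-`N` correction through order 4 once `N ≥ 2`). -/
theorem iteratedDeriv_four_det_besselI_toeplitz_zero (hN : 2 ≤ N) :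
    iteratedDeriv 4 (fun x : ℝ => (Matrix.of fun i j : Fin N => besselI ((i : ℤ) - (j : ℤ)).natAbs x).det) 0 = 3 / 4 := by
  rw [← mgf_trace_re_unitaryGroup_eq N, iteratedDeriv_mgf_zero (mem_interior_integrableExpSet_of_abs_le_const
    (aestronglyMeasurable_trace_re_unitaryGroup N) (fun u => abs_trace_re_le_card u) 0) 4]
  simp only [Pi.pow_apply]
  exact un_integral_re_trace_pow_four hN

/-- The third coefficient vanishes: `(det[I_{|i−j|}])‴(0) = ∫ (Re tr U)³ = 0` (every `N`; `U ↦ −U`). -/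
theorem iteratedDeriv_three_det_besselI_toeplitz_zero (N : ℕ) :
    iteratedDeriv 3 (fun x : ℝ => (Matrix.of fun i j : Fin N => besselI ((i : ℤ) - (j : ℤ)).natAbs x).det) 0 = 0 := by
  rw [← mgf_trace_re_unitaryGroup_eq N, iteratedDeriv_mgf_zero (mem_interior_integrableExpSet_of_abs_le_const
    (aestronglyMeasurable_trace_re_unitaryGroup N) (fun u => abs_trace_re_le_card u) 0) 3]
  simp only [Pi.pow_apply]
  -- sign flip under the central element `-1 = (e^{iπ/2})²·1`: use `w·1` with `w = i`, applied twice is `-1`; directly: `-1 ∈ U(N)`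
  have hm : (-1 : Matrix (Fin N) (Fin N) ℂ) ∈ Matrix.unitaryGroup (Fin N) ℂ := by
    rw [Matrix.mem_unitaryGroup_iff, star_neg, star_one, neg_mul_neg, one_mul]
  have key := integral_mul_left_eq_self (μ := (haarProbability (Matrix.unitaryGroup (Fin N) ℂ))) (fun U : Matrix.unitaryGroup (Fin N) ℂ => ((U : Matrix (Fin N) (Fin N) ℂ)).trace.re ^ 3) ⟨-1, hm⟩
  have hent : ∀ U : Matrix.unitaryGroup (Fin N) ℂ, (((⟨-1, hm⟩ * U : Matrix.unitaryGroup (Fin N) ℂ) : Matrix (Fin N) (Fin N) ℂ)).trace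
      = -((U : Matrix (Fin N) (Fin N) ℂ)).trace := fun U => by
    show ((-1 : Matrix (Fin N) (Fin N) ℂ) * (U : Matrix (Fin N) (Fin N) ℂ)).trace = _
    rw [neg_one_mul, Matrix.trace_neg]
  have hneg : ∀ U : Matrix.unitaryGroup (Fin N) ℂ, (-((U : Matrix (Fin N) (Fin N) ℂ)).trace).re ^ 3 = -(((U : Matrix (Fin N) (Fin N) ℂ)).trace.re ^ 3) := fun U => by
    rw [Complex.neg_re]; ring
  simp only [hent, hneg, integral_neg] at key
  linarith

end Summit.Ventures.LatticeQCDFlow.Scoring
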